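import Summits.ResolutionOfSingularities.ResolutionOfSingularities.Theorems.FrobeniusLadderFRationalResolutionToricLogRegular
import Literature.AlgebraicGeometry.Resolution.ResolutionOfComponents
import Mathlib.LinearAlgebra.Finsupp.LinearCombination
import HarnessLib

/-!
# Resolution of `Spec k[Q]` for every fine saturated monoid `Q ⊆ ℤᴺ` (basis-free form)

Support file for crux stmt-ResolutionOfSingularities-15317 (`FrobeniusLadder.FRationalResolution`), line `redirect`,
brick L5. `hasResolution_Spec_addMonoidAlgebra` (…ToricLogRegular.lean) is stated for Kato's normal form
`P ⊆ ℤⁿ` spanning `ℤⁿ`; the invariant monoids of diagonal actions, `M = {m ∈ ℕᴺ : w·m = 0 in A}`, span only a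
sublattice. Here the normal form is produced from any finitely generated `Q ⊆ ℤᴺ` saturated in the group `ℤQ` it
spans (a `ℤ`-basis of the free module `ℤQ ≅ ℤ^r` transports `Q` to a spanning saturated `P' ⊆ ℤ^r` with
`k[Q] ≅ k[P']`), so that **`Spec k[Q]` has a resolution of singularities for every field `k` and every fine,
saturated, torsion-free monoid `Q` given inside some `ℤᴺ`** (`hasResolution_Spec_addMonoidAlgebra_of_saturated`).

All folklore over the tree's PROVED Kato (10.4); no published fact is used as a hypothesis.
-/

-- single-problem summit: the doubled namespace component is forced
set_option linter.dupNamespace false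

noncomputable section

namespace Summit.ResolutionOfSingularities.ResolutionOfSingularities.Theorems.FRationalResolution

open AddMonoidAlgebra Literature.AlgebraicGeometry.Resolution AlgebraicGeometry

universe u

/-- **Resolution of affine normal toric varieties, basis-free form.** For a field `k` and a finitely generated
submonoid `Q ⊆ ℤᴺ` which is saturated in the subgroup `ℤQ` it spans (`m v ∈ Q`, `v ∈ ℤQ`, `m ≥ 1` `⇒ v ∈ Q`),
`Spec k[Q]` has a resolution of singularities. [cite: Kato1994, (10.4)] -/
theorem hasResolution_Spec_addMonoidAlgebra_of_saturated (k : Type) [Field k] {N : ℕ}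
    (Q : AddSubmonoid (Fin N → ℤ)) (hQ : Q.FG)
    (hsat : ∀ v ∈ Submodule.span ℤ (Q : Set (Fin N → ℤ)), ∀ m : ℕ, 0 < m → m • v ∈ Q → v ∈ Q) :
    Scheme.HasResolution (Spec (.of (AddMonoidAlgebra k ↥Q))) := by
  classical
  set H : Submodule ℤ (Fin N → ℤ) := Submodule.span ℤ (Q : Set (Fin N → ℤ)) with hHdef
  -- a `ℤ`-basis of the free module `ℤQ`
  set r := Module.finrank ℤ ↥H with hrdef
  let e : ↥H ≃ₗ[ℤ] (Fin r → ℤ) :=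
    (Module.finBasis ℤ ↥H).repr.trans (Finsupp.linearEquivFunOnFinite ℤ ℤ (Fin r))
  let ι : ↥Q →+ ↥H :=
    { toFun := fun q => ⟨(q : Fin N → ℤ), Submodule.subset_span q.2⟩
      map_zero' := rfl
      map_add' := fun _ _ => rfl }
  have hι : Function.Injective ι := fun a b hab => by
    have h := congrArg Subtype.val hab
    exact Subtype.ext h
  let f : ↥Q →+ (Fin r → ℤ) := e.toLinearMap.toAddMonoidHom.comp ι
  have hf : ∀ q, f q = e (ι q) := fun _ => rfl
  have hfinj : Function.Injective f := e.injective.comp hι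
  -- the normal form `P' = f(Q) ⊆ ℤ^r`
  set P' : AddSubmonoid (Fin r → ℤ) := AddMonoidHom.mrange f with hP'def
  haveI : AddMonoid.FG ↥Q := (AddMonoid.fg_iff_addSubmonoid_fg Q).2 hQ
  have hP'fg : P'.FG := by
    rw [hP'def, AddMonoidHom.mrange_eq_map]
    exact AddSubmonoid.FG.map AddMonoid.FG.fg_top f
  have hspanH : Submodule.span ℤ (Set.range ι) = ⊤ := by
    have h := Submodule.span_span_coe_preimage (R := ℤ) (s := (Q : Set (Fin N → ℤ)))
    rw [← hHdef] at h
    rw [← h]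
    congr 1
    ext ⟨x, hx⟩
    constructor
    · rintro ⟨q, hq⟩
      rw [← hq]; exact q.2
    · intro hx'
      exact ⟨⟨x, hx'⟩, rfl⟩
  have hspan : Submodule.span ℤ (P' : Set (Fin r → ℤ)) = ⊤ := by
    have h1 : (P' : Set (Fin r → ℤ)) = e '' Set.range ι := by
      ext v
      constructor
      · rintro ⟨q, rfl⟩
        exact ⟨ι q, ⟨q, rfl⟩, rfl⟩
      · rintro ⟨_, ⟨q, rfl⟩, rfl⟩
        exact ⟨q, rfl⟩
    have h2 : Submodule.span ℤ (⇑e '' Set.range ⇑ι) = (Submodule.span ℤ (Set.range ι)).map e.toLinearMap := by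
      rw [Submodule.map_span]; rfl
    rw [h1, h2, hspanH, Submodule.map_top, LinearMap.range_eq_top]
    exact e.surjective
  have hsat' : ∀ (v : Fin r → ℤ) (m : ℕ), 0 < m → m • v ∈ P' → v ∈ P' := by
    intro v m hm hmv
    obtain ⟨q, hq⟩ := hmv
    have hq' : ι q = m • e.symm v := by
      apply e.injective
      rw [← hf, hq, map_nsmul, LinearEquiv.apply_symm_apply]
    have hmem : ((m • e.symm v : ↥H) : Fin N → ℤ) ∈ Q := by
      rw [← hq']; exact q.2
    have hv : ((e.symm v : ↥H) : Fin N → ℤ) ∈ Q :=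
      hsat _ (e.symm v).2 m hm (by simpa using hmem)
    refine ⟨⟨_, hv⟩, ?_⟩
    rw [hf]
    have : ι ⟨_, hv⟩ = e.symm v := Subtype.ext rfl
    rw [this, LinearEquiv.apply_symm_apply]
  -- `k[Q] ≅ k[P']`
  let eQ : ↥Q ≃+ ↥P' := AddEquiv.ofBijective f.mrangeRestrict
    ⟨fun a b hab => hfinj (congrArg Subtype.val hab), AddMonoidHom.mrangeRestrict_surjective f⟩
  let eA : AddMonoidAlgebra k ↥Q ≃ₐ[k] AddMonoidAlgebra k ↥P' := AddMonoidAlgebra.domCongr k k eQ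
  have hres : Scheme.HasResolution (Spec (.of (AddMonoidAlgebra k ↥P'))) :=
    hasResolution_Spec_addMonoidAlgebra k P' hP'fg hsat' hspan
  exact Scheme.HasResolution.of_iso (Spec.map eA.toRingEquiv.toCommRingCatIso.hom) hres

end Summit.ResolutionOfSingularities.ResolutionOfSingularities.Theorems.FRationalResolution

end
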